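import Literature.Claims.NS.Solanki2026
import Summits.NavierStokesRegularity.NavierStokesRegularity.Theorems.SoloRefuteFaliush2026Thm1
import Mathlib.Analysis.Complex.ExponentialBounds
import HarnessLib

/-!
# C176 `Solanki2026` — refutation of Lemma 1 (Bilinear Quenching), display (2) p.2 l.4–22
# (= Appendix A (5) p.3 l.28–34), typed `Literature.Claims.NS.Solanki2026.Step_L1`
# (refuter of record: ns-claims-refuter-7 g5; cell ns-claims, D-0090; RULINGS v1.50 (1)–(2))

**Printed statement (Lemma 1, display (2), p.2 l.14–22; text of record Zenodo 19633460, sha16 09f47817023af2a6).**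
«In the Gevrey Banach algebra, the non-linear operator satisfies the strict inequality:
‖B(u, u)‖_{G_R} ≤ C √t ‖u‖²_{G_R} (2) where C is a universal geometric constant independent of the initial
data (see Appendix A).» Typed (typist-5 g7, p552494) as `Step_L1 : ∃ C, ∀ ν > 0, ∀ t > 0, ∀ v` smooth,
divergence-free, `‖v‖_{G_R(t)} < ∞` `→ GR ν t (B v) ≤ C * √t * GR ν t v ^ 2`, with `G_R` = Definition 1 (1)
p.1 l.23–31 (`Σ_{k∈ℤ³} |v̂(k)| e^{√(νt)|k|}`) and `B v = (v·∇)v` (`Torus.convect v v`, App. A (3)).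

**HEAD = `Step_L1`, CLASS = FALSE LEMMA (countermodel; kernel object = the explicit inequality (2)).**
Witness (DEGENERATE-WITNESS rule respected: a genuine, non-zero, smooth, divergence-free trigonometric
polynomial — the two-shell triad `vW` of the C141 `Faliush2026` Theorem 1 kit, Fourier support
`S = {±(2,0,0), ±(−1,1,0), ±(−1,−1,0)}`, `(vW·∇)vW ≠ 0` with `((vW·∇)vW)^(2,0,0) = −π e_z`), viscosity
`ν = 1`, and the time `t_C = a² ∈ (0, 1]`, `a = 1/(2304(|C|+1))`, for the purported constant `C`:
* left side:  `‖(vW·∇)vW‖_{G_R(t)} ≥ |((vW·∇)vW)^(2,0,0)| · e^{√t·2} ≥ π` for EVERY `t ≥ 0` (`pi_le_GR_B_vW`);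
* right side: `‖vW‖_{G_R(t)} = Σ_{k∈S} |v̂W(k)| e^{√t|k|} ≤ 6 · 1 · e² ≤ 48` for `0 ≤ t ≤ 1` (`GR_vW_le`), so
  `C √(t_C) ‖vW‖²_{G_R(t_C)} ≤ |C| · a · 48² = |C|/(|C|+1) < 1 < 3 < π`.
Hence (2) fails at `(ν, t, v) = (1, t_C, vW)` for every real `C` (`not_Step_L1`). Mechanism, for the record:
(2) bounds a quadratic FIRST-ORDER form by `√t ×` (zeroth-order norm)²; as `t → 0⁺` the right side vanishes
while the left side does not (the print's App. A (3)–(5) derive only the sub-multiplicativity of the weight and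
Young's inequality — no displayed step produces the factor `√t`, p.3 l.7–34).

LETTERING (RULING 12:45Z (1)): `Step_L1` is the FIRST binder of the consumed chain
`claim_of_steps : Step_L1 → Step_R1 → Step_T1 → ClaimedTheorem` (skeleton §D) and carries a print-faithful
kernel object (display (2)); `Step_R1`/`Step_T1` are the prose implications of Remark 1 / the proof of Thm 1
(records: with `Step_L1` false, `Step_R1 := Step_L1 → NormStaysFinite` holds vacuously — `step_R1_of_not_L1`).

* `not_Step_L1 : ¬ Literature.Claims.NS.Solanki2026.Step_L1` — the kill (std axioms).
* `step_R1_of_not_L1 : Literature.Claims.NS.Solanki2026.Step_R1` — records (vacuous truth of Step 2 as typed).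

WHAT THIS IS NOT: not a claim about NS regularity or blow-up; not a claim about any author beyond the
typed locator. [cite: Solanki2026, Lemma 1 (2) p.2 l.4–22; App. A (3)–(5) p.2 l.54 – p.3 l.39]
-/

set_option linter.dupNamespace false

noncomputable section

open Literature.Analysis.FunctionSpaces Literature.Analysis.FunctionSpaces.Torus
open Literature.Analysis.FluidPDE Literature.Analysis.FluidPDE.Torus
open Literature.Claims.NS.Faliush2026 (T3 E3 Z3 coeff)
open Literature.Claims.NS.Solanki2026
open Summit.NavierStokesRegularity.NavierStokesRegularity.Theorems.Faliush2026Thm1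
  (k₁ k₂ k₃ S c ez eh vW sum_S mem_S_iff c_k₁ c_nk₁ c_k₂ c_nk₂ c_k₃ c_nk₃ c_of_not_mem isSmooth_vW
    isDivFree_vW coeff_vW coeff_convect_vW CC_k₁ freqNormSq_k₁ freqNormSq_k₂ freqNormSq_k₃)

namespace Summit.NavierStokesRegularity.NavierStokesRegularity.Theorems.Solanki2026

/-! ## Finite Fourier support of the witness and of its convection term -/

/-- Off the sum-set `S + S` the Galerkin convolution coefficient vanishes. [folklore] -/
theorem convectionCoeff_eq_zero_of_not_mem {k : Z3}
    (hk : k ∉ (S ×ˢ S).image (fun p : Z3 × Z3 => p.1 + p.2)) : convectionCoeff S c c k = 0 := by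
  rw [convectionCoeff_def]
  exact Finset.sum_eq_zero fun l hl => Finset.sum_eq_zero fun m hm =>
    if_neg fun h => hk (Finset.mem_image.2 ⟨(l, m), Finset.mem_product.2 ⟨hl, hm⟩, h⟩)

/-- `‖vW‖_{G_R(t)} < ∞` (finite Fourier support). [folklore] -/
theorem finiteGR_vW (ν t : ℝ) : FiniteGR ν t vW :=
  summable_of_ne_finset_zero (s := S) fun k hk => by
    show ‖coeff vW k‖ * gevreyWeight ν t k = 0
    rw [coeff_vW, if_neg hk, norm_zero, zero_mul]

/-- `‖(vW·∇)vW‖_{G_R(t)} < ∞` (finite Fourier support `⊆ S + S`). [folklore] -/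
theorem summable_gevreyTerm_B_vW (ν t : ℝ) : Summable (gevreyTerm ν t (B vW)) :=
  summable_of_ne_finset_zero (s := (S ×ˢ S).image (fun p : Z3 × Z3 => p.1 + p.2)) fun k hk => by
    show ‖coeff (Torus.convect vW vW) k‖ * gevreyWeight ν t k = 0
    rw [coeff_convect_vW, convectionCoeff_eq_zero_of_not_mem hk, norm_zero, zero_mul]

/-! ## The two sides of (2) on the witness -/

/-- `‖e_x + e_y‖ ≤ 2`. [folklore] -/
theorem norm_eh_le : ‖eh‖ ≤ 2 := by
  show ‖EuclideanSpace.single (0 : Fin 3) (1 : ℂ) + EuclideanSpace.single (1 : Fin 3) (1 : ℂ)‖ ≤ 2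
  refine (norm_add_le _ _).trans ?_
  have h0 : ‖EuclideanSpace.single (0 : Fin 3) (1 : ℂ)‖ = 1 := by simp
  have h1 : ‖EuclideanSpace.single (1 : Fin 3) (1 : ℂ)‖ = 1 := by simp
  rw [h0, h1]
  norm_num

/-- Every Fourier coefficient of the witness has norm `≤ 1` (`‖e_z‖ = 1`, `‖e_x + e_y‖ ≤ 2`). [folklore] -/
theorem norm_c_le_one (k : Z3) : ‖c k‖ ≤ 1 := by
  have norm_ez : ‖ez‖ = 1 := by simp [ez]
  by_cases hk : k ∈ S
  · rw [mem_S_iff] at hk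
    rcases hk with rfl | rfl | rfl | rfl | rfl | rfl
    · rw [c_k₁, norm_smul, norm_ez]; norm_num
    · rw [c_nk₁, norm_smul, norm_ez]; norm_num
    · rw [c_k₂, norm_smul]
      calc ‖(1 / 2 : ℂ)‖ * ‖eh‖ ≤ ‖(1 / 2 : ℂ)‖ * 2 := by gcongr; exact norm_eh_le
        _ = 1 := by norm_num
    · rw [c_nk₂, norm_smul]
      calc ‖(1 / 2 : ℂ)‖ * ‖eh‖ ≤ ‖(1 / 2 : ℂ)‖ * 2 := by gcongr; exact norm_eh_le
        _ = 1 := by norm_num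
    · rw [c_k₃, norm_smul, norm_ez, norm_neg, norm_div, Complex.norm_I]; norm_num
    · rw [c_nk₃, norm_smul, norm_ez, norm_div, Complex.norm_I]; norm_num
  · rw [c_of_not_mem hk, norm_zero]; exact zero_le_one

/-- On the support, `|k| ≤ 2`. [folklore] -/
theorem freqNorm_le_two {k : Z3} (hk : k ∈ S) : freqNorm k ≤ 2 := by
  have h4 : Torus.freqNormSq k ≤ 4 := by
    rw [mem_S_iff] at hk
    rcases hk with rfl | rfl | rfl | rfl | rfl | rfl
    · rw [freqNormSq_k₁]
    · rw [freqNormSq_neg, freqNormSq_k₁]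
    · rw [freqNormSq_k₂]; norm_num
    · rw [freqNormSq_neg, freqNormSq_k₂]; norm_num
    · rw [freqNormSq_k₃]; norm_num
    · rw [freqNormSq_neg, freqNormSq_k₃]; norm_num
  unfold freqNorm
  rw [show (2 : ℝ) = Real.sqrt (2 ^ 2) from (Real.sqrt_sq (by norm_num)).symm]
  exact Real.sqrt_le_sqrt (by linarith)

/-- Definition 1's weight on the support for `0 ≤ t ≤ 1`, `ν = 1`: `e^{√t|k|} ≤ e² ≤ 8`. [folklore] -/
theorem gevreyWeight_le {t : ℝ} (ht1 : t ≤ 1) {k : Z3} (hk : k ∈ S) : gevreyWeight 1 t k ≤ 8 := by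
  have exp_two_le_eight : Real.exp 2 ≤ 8 := by
    rw [show (2 : ℝ) = 1 + 1 by norm_num, Real.exp_add]
    nlinarith [Real.exp_one_lt_d9, Real.exp_pos 1]
  unfold gevreyWeight
  refine (Real.exp_le_exp.2 ?_).trans exp_two_le_eight
  have hs : Real.sqrt (1 * t) ≤ 1 := Real.sqrt_le_one.2 (by linarith)
  have hf : 0 ≤ freqNorm k := Real.sqrt_nonneg _
  calc Real.sqrt (1 * t) * freqNorm k ≤ 1 * 2 :=
        mul_le_mul hs (freqNorm_le_two hk) hf zero_le_one
    _ = 2 := by norm_num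

/-- **Right side of (2) on the witness**: `‖vW‖_{G_R(t)} ≤ 48` for `0 ≤ t ≤ 1`, `ν = 1`. [folklore] -/
theorem GR_vW_le {t : ℝ} (ht1 : t ≤ 1) : GR 1 t vW ≤ 48 := by
  unfold GR
  rw [tsum_eq_sum (s := S) (fun k hk => by
    show ‖coeff vW k‖ * gevreyWeight 1 t k = 0
    rw [coeff_vW, if_neg hk, norm_zero, zero_mul])]
  have hterm : ∀ k ∈ S, gevreyTerm 1 t vW k ≤ 8 := fun k hk => by
    show ‖coeff vW k‖ * gevreyWeight 1 t k ≤ 8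
    rw [coeff_vW, if_pos hk]
    calc ‖c k‖ * gevreyWeight 1 t k ≤ 1 * 8 :=
          mul_le_mul (norm_c_le_one k) (gevreyWeight_le ht1 hk) (Real.exp_pos _).le zero_le_one
      _ = 8 := by norm_num
  calc ∑ k ∈ S, gevreyTerm 1 t vW k ≤ ∑ _k ∈ S, (8 : ℝ) := Finset.sum_le_sum hterm
    _ = 48 := by rw [sum_S]; norm_num

/-- `‖v‖_{G_R(t)} ≥ 0` (nonnegative summands). [folklore] -/
theorem GR_nonneg (ν t : ℝ) (v : T3 → E3) : 0 ≤ GR ν t v :=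
  tsum_nonneg fun _ => mul_nonneg (norm_nonneg _) (Real.exp_pos _).le

/-- **Left side of (2) on the witness**: `‖(vW·∇)vW‖_{G_R(t)} ≥ π` for every `ν` and every `t`
(the `(2,0,0)`-coefficient of `(vW·∇)vW` is `−π e_z`, and Definition 1's weight is `≥ 1`). [folklore] -/
theorem pi_le_GR_B_vW (ν t : ℝ) : Real.pi ≤ GR ν t (B vW) := by
  have norm_ez : ‖ez‖ = 1 := by simp [ez]
  have hk₁ : gevreyTerm ν t (B vW) k₁ = Real.pi * gevreyWeight ν t k₁ := by
    show ‖coeff (Torus.convect vW vW) k₁‖ * gevreyWeight ν t k₁ = _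
    rw [coeff_convect_vW, CC_k₁, norm_smul, norm_neg, Complex.norm_real, Real.norm_eq_abs,
      abs_of_pos Real.pi_pos, norm_ez, mul_one]
  have hw : 1 ≤ gevreyWeight ν t k₁ :=
    Real.one_le_exp (mul_nonneg (Real.sqrt_nonneg _) (Real.sqrt_nonneg _))
  calc Real.pi ≤ Real.pi * gevreyWeight ν t k₁ := le_mul_of_one_le_right Real.pi_pos.le hw
    _ = gevreyTerm ν t (B vW) k₁ := hk₁.symm
    _ ≤ GR ν t (B vW) := (summable_gevreyTerm_B_vW ν t).le_tsum k₁
        (fun k _ => mul_nonneg (norm_nonneg _) (Real.exp_pos _).le)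

/-! ## The refutation -/

/-- **Refutation of Lemma 1 (Bilinear Quenching), display (2)** (`Literature.Claims.NS.Solanki2026.Step_L1`,
p.2 l.4–22 = App. A (5) p.3 l.28–34; «‖B(u,u)‖_{G_R} ≤ C√t‖u‖²_{G_R}, C a universal geometric constant
independent of the initial data»): FALSE as typed — for every real `C`, at `ν = 1`, `t = (2304(|C|+1))⁻²` and
the smooth divergence-free two-shell trigonometric polynomial `vW` (non-zero convection term), the left side
is `≥ π` while the right side is `≤ |C|/(|C|+1) < 1`. Class: false lemma (countermodel); the witness is a
genuine non-degenerate field at a positive time inside the typed range `t > 0`.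
[cite: Solanki2026, Lemma 1 (2) p.2 l.4–22; App. A (5) p.3 l.28–34] -/
theorem not_Step_L1 : ¬ Step_L1 := by
  rintro ⟨C, hC⟩
  set a : ℝ := 1 / (2304 * (|C| + 1)) with ha
  have hC1 : 0 < |C| + 1 := by positivity
  have ha0 : 0 < a := by positivity
  have hmul : 2304 * (|C| + 1) * a = 1 := by
    rw [ha]; field_simp
  have ha1 : a ≤ 1 := by nlinarith [abs_nonneg C]
  have ht0 : 0 < a ^ 2 := by positivity
  have ht1 : a ^ 2 ≤ 1 := pow_le_one₀ ha0.le ha1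
  have h := hC 1 one_pos (a ^ 2) ht0 vW isSmooth_vW isDivFree_vW (finiteGR_vW 1 (a ^ 2))
  rw [Real.sqrt_sq ha0.le] at h
  have hlow := pi_le_GR_B_vW 1 (a ^ 2)
  have hup : GR 1 (a ^ 2) vW ≤ 48 := GR_vW_le ht1
  have hnn : 0 ≤ GR 1 (a ^ 2) vW := GR_nonneg 1 (a ^ 2) vW
  have hG2 : GR 1 (a ^ 2) vW ^ 2 ≤ 48 ^ 2 := pow_le_pow_left₀ hnn hup 2
  have hrhs : C * a * GR 1 (a ^ 2) vW ^ 2 ≤ |C| * a * 48 ^ 2 := by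
    have haG : 0 ≤ a * GR 1 (a ^ 2) vW ^ 2 := by positivity
    have h1 : C * a * GR 1 (a ^ 2) vW ^ 2 ≤ |C| * a * GR 1 (a ^ 2) vW ^ 2 := by
      nlinarith [mul_nonneg (sub_nonneg.2 (le_abs_self C)) haG]
    have h2 : |C| * a * GR 1 (a ^ 2) vW ^ 2 ≤ |C| * a * 48 ^ 2 :=
      mul_le_mul_of_nonneg_left hG2 (by positivity)
    exact h1.trans h2
  have key : |C| * a * 48 ^ 2 < 1 := by nlinarith [abs_nonneg C]
  linarith [Real.pi_gt_three]

/-- Records: with (2) false, Step 2 as typed (`Step_R1 := Step_L1 → NormStaysFinite`, Remark 1 p.2 l.23–34)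
holds VACUOUSLY — it is not the head. [cite: Solanki2026, Remark 1 p.2 l.23–34] -/
theorem step_R1_of_not_L1 : Step_R1 := fun h => (not_Step_L1 h).elim

end Summit.NavierStokesRegularity.NavierStokesRegularity.Theorems.Solanki2026

end
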